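import Summits.ResolutionOfSingularities.ResolutionOfSingularities.Theorems.FrobeniusLadderFInjectiveMacaulayficationE4FloorTwoWChart
import HarnessLib

/-!
# E4″@G floor 2: the five charts of `Bl_𝔪 G` — `D₊(a)`, `D₊(b)` are regular, and the blowing ups of `D₊(w₂)`, `D₊(w₃)` along their singular curves are regular (by the
# variable swaps `(2 3)`, `(2 4)` from the `D₊(w₁)` chart of `E4FloorTwoWChart`); the centres `J_i` are prime
# (E4″@G T-side, (F3-w) complement and (F2) ring side; crux `FInjectiveMacaulayfication` stmt-ResolutionOfSingularities-15315, chain w45a; res-L1-w45a-plan-1 R19.1/R19.3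
# «stub-1 g11: (F3-w) → (F2) part 2 → (F3) glue → (ROW)»; seat res-L1-w45a-stub-1 g11)

[OURS · L1 W4.5a] Support file (`--supports stmt-ResolutionOfSingularities-15315 --as helper`); replaces the role of NO printed item; NOT a statement of any
manuscript; def-free; UNCONDITIONAL. AI-written (AI review is weaker than expert review).

Coordinates of res-L1-w45a-stub-2's `E4GermPointBlowupFull.theta` (`G = {X₀X₁ + X₂³ + X₃³ + X₄³ = 0}`, char 2; five strict transforms `g₀, …, g₄`).
* §1 `isRegularRing_chartZero/One` — `C₀ = k[X]/(X₁ + X₀(X₂³+X₃³+X₄³))` and `C₁ = k[X]/(X₀ + X₁(X₂³+X₃³+X₄³))` are REGULAR rings (Stacks 07PF: `∂_{X₁} g₀ = 1`, `∂_{X₀} g₁ = 1`).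
* §2 generic: `isPrime_map_span_cen` (the centre `(T₀,T₁,T₂,C g)·(Λ[T]/(h))` is prime when `Λ/(g)` is a domain); `exists_quotientEquiv_rename` (a variable permutation `σ` with
  `σ·g′ = g`, `σ·c′ = c` induces `k[X]/(g′) ≃+* k[X]/(g)` matching the centres); `isPrime_chartTwo` (`J₂` is prime).
* §3 chart `D₊(w₂)` (`g₃ = X₀X₁ + X₃(1 + X₂³ + X₄³)`, `c₃ = (X₀, X₁, X₃, 1 + X₂³ + X₄³)`) and chart `D₊(w₃)` (`g₄ = X₀X₁ + X₄(1 + X₂³ + X₃³)`, `c₄ = (X₀, X₁, X₄, 1 + X₂³ + X₃³)`):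
  ★★ `isRegularRing_blowupAlgebra_chartThree/Four`, ★★ `isRegular_affineBlowup_chartThree/Four` (`Scheme.IsRegular (affineBlowup J_i)`),
  ★ `not_isRegularLocalRing_iff_chartThree/Four` (`Sing(Spec C_i) = V(J_i)`), `isPrime_chartThree/Four` — all hypotheses `3 ≠ 0` in `k` (e.g. characteristic 2).
[folklore; cite: Liu2002, Thm. 8.1.19 (a); StacksProject, Tag 07PF; GortzWedhorn2020, Prop. 13.96 (2)]
-/

-- single-problem summit: the doubled namespace component is forced
set_option linter.dupNamespace false

noncomputable section

namespace Summit.ResolutionOfSingularities.ResolutionOfSingularities.Theorems.FInjectiveMacaulayfication.E4FloorTwoCharts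

open MvPolynomial Literature.AlgebraicGeometry.Resolution AlgebraicGeometry
open Summit.ResolutionOfSingularities.ResolutionOfSingularities.Theorems.FInjectiveMacaulayfication

/-! ## §1 The charts `D₊(a)`, `D₊(b)` are regular -/

/-- **`C₀ = k[X₀..X₄]/(X₁ + X₀(X₂³ + X₃³ + X₄³))` is a regular ring**: `∂g₀/∂X₁ = 1` (Stacks 07PF). [cite: StacksProject, Tag 07PF] -/
theorem isRegularRing_chartZero (k : Type) [Field k] (g₀ : MvPolynomial (Fin 5) k) (hg₀ : g₀ = X 1 + X 0 * (X 2 ^ 3 + X 3 ^ 3 + X 4 ^ 3)) :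
    IsRegularRing (MvPolynomial (Fin 5) k ⧸ Ideal.span {g₀}) := by
  have hd : (pderiv 1 : Derivation k (MvPolynomial (Fin 5) k) (MvPolynomial (Fin 5) k)) g₀ = 1 := by
    rw [hg₀]
    simp only [map_add, Derivation.leibniz, pderiv_pow, pderiv_X_self, pderiv_X_of_ne (show (0 : Fin 5) ≠ 1 by decide),
      pderiv_X_of_ne (show (2 : Fin 5) ≠ 1 by decide), pderiv_X_of_ne (show (3 : Fin 5) ≠ 1 by decide),
      pderiv_X_of_ne (show (4 : Fin 5) ≠ 1 by decide), smul_eq_mul, mul_zero, add_zero]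
  refine isRegularRing_quotient_of_derivation g₀ (pderiv 1 : Derivation k (MvPolynomial (Fin 5) k) (MvPolynomial (Fin 5) k)) ?_
  rw [hd, map_one]; exact isUnit_one

/-- **`C₁ = k[X₀..X₄]/(X₀ + X₁(X₂³ + X₃³ + X₄³))` is a regular ring**: `∂g₁/∂X₀ = 1` (Stacks 07PF). [cite: StacksProject, Tag 07PF] -/
theorem isRegularRing_chartOne (k : Type) [Field k] (g₁ : MvPolynomial (Fin 5) k) (hg₁ : g₁ = X 0 + X 1 * (X 2 ^ 3 + X 3 ^ 3 + X 4 ^ 3)) :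
    IsRegularRing (MvPolynomial (Fin 5) k ⧸ Ideal.span {g₁}) := by
  have hd : (pderiv 0 : Derivation k (MvPolynomial (Fin 5) k) (MvPolynomial (Fin 5) k)) g₁ = 1 := by
    rw [hg₁]
    simp only [map_add, Derivation.leibniz, pderiv_pow, pderiv_X_self, pderiv_X_of_ne (show (1 : Fin 5) ≠ 0 by decide),
      pderiv_X_of_ne (show (2 : Fin 5) ≠ 0 by decide), pderiv_X_of_ne (show (3 : Fin 5) ≠ 0 by decide),
      pderiv_X_of_ne (show (4 : Fin 5) ≠ 0 by decide), smul_eq_mul, mul_zero, add_zero]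
  refine isRegularRing_quotient_of_derivation g₁ (pderiv 0 : Derivation k (MvPolynomial (Fin 5) k) (MvPolynomial (Fin 5) k)) ?_
  rw [hd, map_one]; exact isUnit_one

/-! ## §2 Generic: primality of the centre; permutation bridges -/

/-- **The centre `J = (T₀, T₁, T₂, C g)·(R/(h))` is a prime ideal** when `Λ/(g)` is a domain: `(R/(h))/J ≅ R/I ≅ Λ/(g)` (`h ∈ I² ⊆ I`). [folklore] -/
theorem isPrime_map_span_cen {Λ : Type} [CommRing Λ] (g : Λ) [IsDomain (Λ ⧸ Ideal.span {g})] (cen : Fin 4 → MvPolynomial (Fin 3) Λ)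
    (hcen : cen = ![X 0, X 1, X 2, C g]) (h : MvPolynomial (Fin 3) Λ) (hh : h = X 0 * X 1 + X 2 * C g) :
    ((Ideal.span (Set.range cen)).map (Ideal.Quotient.mk (Ideal.span {h}))).IsPrime := by
  haveI := ODPCurveCentre.isDomain_quotient g cen hcen
  haveI : (Ideal.span (Set.range cen)).IsPrime := (Ideal.Quotient.isDomain_iff_prime _).mp inferInstance
  refine Ideal.map_isPrime_of_surjective Ideal.Quotient.mk_surjective ?_
  rw [Ideal.mk_ker, Ideal.span_le, Set.singleton_subset_iff]
  exact Ideal.pow_le_self two_ne_zero (ODPCurveCentre.h_mem_sq g cen h hcen hh)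

/-- **A permutation of the variables with `σ·g′ = g`, `σ·c′ = c` induces `k[X]/(g′) ≃+* k[X]/(g)` carrying the centre `(c′)` onto `(c)` generator by generator.** [folklore] -/
theorem exists_quotientEquiv_rename (k : Type) [Field k] (σ : Equiv.Perm (Fin 5)) (g g' : MvPolynomial (Fin 5) k) (hgg' : rename σ g' = g)
    (c c' : Fin 4 → MvPolynomial (Fin 5) k) (hcc' : ∀ p, rename σ (c' p) = c p)
    (J : Ideal (MvPolynomial (Fin 5) k ⧸ Ideal.span {g})) (hJ : J = (Ideal.span (Set.range c)).map (Ideal.Quotient.mk (Ideal.span {g})))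
    (J' : Ideal (MvPolynomial (Fin 5) k ⧸ Ideal.span {g'})) (hJ' : J' = (Ideal.span (Set.range c')).map (Ideal.Quotient.mk (Ideal.span {g'}))) :
    ∃ εq : (MvPolynomial (Fin 5) k ⧸ Ideal.span {g'}) ≃+* (MvPolynomial (Fin 5) k ⧸ Ideal.span {g}),
      (∀ p, εq (Ideal.Quotient.mk (Ideal.span {g'}) (c' p)) = Ideal.Quotient.mk (Ideal.span {g}) (c p)) ∧ Ideal.map εq J' = J := by
  let ε : MvPolynomial (Fin 5) k ≃+* MvPolynomial (Fin 5) k := (renameEquiv k σ).toRingEquiv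
  have hε : ∀ x, ε x = rename σ x := fun x => rfl
  have hmap : Ideal.span {g} = (Ideal.span {g'}).map (ε : MvPolynomial (Fin 5) k →+* MvPolynomial (Fin 5) k) := by
    rw [Ideal.map_span, Set.image_singleton]
    exact congrArg _ (congrArg _ (by rw [RingEquiv.coe_toRingHom, hε, hgg'])).symm
  let εq := Ideal.quotientEquiv (Ideal.span {g'}) (Ideal.span {g}) ε hmap
  have hεq : ∀ x, εq (Ideal.Quotient.mk (Ideal.span {g'}) x) = Ideal.Quotient.mk (Ideal.span {g}) (ε x) := fun x =>
    Ideal.quotientEquiv_mk _ _ _ _ x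
  refine ⟨εq, fun p => by rw [hεq, hε, hcc'], ?_⟩
  have hcomp : (εq : _ →+* _).comp (Ideal.Quotient.mk (Ideal.span {g'})) =
      (Ideal.Quotient.mk (Ideal.span {g})).comp (ε : MvPolynomial (Fin 5) k →+* MvPolynomial (Fin 5) k) :=
    RingHom.ext fun x => hεq x
  have hfun : ((ε : MvPolynomial (Fin 5) k →+* MvPolynomial (Fin 5) k) ∘ c' : Fin 4 → _) = c :=
    funext fun p => by rw [Function.comp_apply, RingEquiv.coe_toRingHom, hε]; exact hcc' p
  have key : Ideal.map (εq : _ →+* _) J' = J := by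
    rw [hJ', hJ, Ideal.map_map, hcomp, ← Ideal.map_map, Ideal.map_span, ← Set.range_comp, hfun]
  exact key

/-- Transport package along a quotient bridge `εq : C′ ≃+* C` matching centres: chart-ring regularity, `Sing = V(J)` and primality descend from `C` to `C′`. [plumbing] -/
theorem transport_of_quotientEquiv {A B : Type} [CommRing A] [CommRing B] (εq : A ≃+* B) (c' : Fin 4 → A) (c : Fin 4 → B)
    (hc : ∀ p, εq (c' p) = c p) (J' : Ideal A) (J : Ideal B) (hJ : Ideal.map εq J' = J)
    (hreg : ∀ p : Fin 4, IsRegularRing (blowupAlgebra J (c p)))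
    (hsing : ∀ (Q : Ideal B) [Q.IsPrime], ¬ IsRegularLocalRing (Localization.AtPrime Q) ↔ J ≤ Q) (hprime : J.IsPrime) :
    (∀ p : Fin 4, IsRegularRing (blowupAlgebra J' (c' p))) ∧
      (∀ (P : Ideal A) [P.IsPrime], ¬ IsRegularLocalRing (Localization.AtPrime P) ↔ J' ≤ P) ∧ J'.IsPrime := by
  have hJ'c : J' = J.comap εq := by
    rw [← hJ]; exact (Ideal.comap_map_of_bijective εq εq.bijective).symm
  refine ⟨fun p => E4FloorTwoWChart.isRegularRing_blowupAlgebra_of_ringEquiv εq J' (c' p) J (c p) hJ.symm (hc p).symm (hreg p), fun P _ => ?_, ?_⟩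
  · haveI hQ : (P.map εq).IsPrime := Ideal.map_isPrime_of_equiv εq
    have hPc : P = (P.map εq).comap εq := (Ideal.comap_map_of_bijective εq εq.bijective).symm
    rw [E4FloorTwoWChart.isRegularLocalRing_localization_iff_of_ringEquiv εq P (P.map εq) hPc, hsing, ← hJ, Ideal.map_le_iff_le_comap, ← hPc]
  · rw [hJ'c]; exact Ideal.comap_isPrime εq J

/-- `J₂` is prime, over an ABSTRACT copy `Λ` of `k[U,V]` (instantiate with `ι = RingEquiv.refl`). [plumbing] -/
theorem isPrime_chartTwo_aux (k : Type) [Field k] {Λ : Type} [CommRing Λ] (ι : MvPolynomial (Fin 2) k ≃+* Λ)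
    (g : Λ) (hg : g = ι (1 + X 0 ^ 3 + X 1 ^ 3)) [IsDomain (Λ ⧸ Ideal.span {g})]
    (g₂ : MvPolynomial (Fin 5) k) (hg₂ : g₂ = X 0 * X 1 + X 2 * (1 + X 3 ^ 3 + X 4 ^ 3))
    (c₂ : Fin 4 → MvPolynomial (Fin 5) k) (hc₂ : c₂ = ![X 0, X 1, X 2, 1 + X 3 ^ 3 + X 4 ^ 3])
    (J₂ : Ideal (MvPolynomial (Fin 5) k ⧸ Ideal.span {g₂})) (hJ₂ : J₂ = (Ideal.span (Set.range c₂)).map (Ideal.Quotient.mk (Ideal.span {g₂}))) :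
    J₂.IsPrime := by
  obtain ⟨εq, -, hJ⟩ := E4FloorTwoWChart.exists_quotientEquiv_chartTwo k ι g₂ hg₂ c₂ hc₂ J₂ hJ₂ g hg _ rfl _ rfl
  have hJ'c : J₂ = ((Ideal.span (Set.range (![X 0, X 1, X 2, C g] : Fin 4 → MvPolynomial (Fin 3) Λ))).map
      (Ideal.Quotient.mk (Ideal.span {(X 0 * X 1 + X 2 * C g : MvPolynomial (Fin 3) Λ)}))).comap εq := by
    rw [← hJ]; exact (Ideal.comap_map_of_bijective εq εq.bijective).symm
  haveI := isPrime_map_span_cen g _ rfl _ rfl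
  rw [hJ'c]; exact Ideal.comap_isPrime εq _

/-- **`J₂ = (X₀, X₁, X₂, 1 + X₃³ + X₄³)·C₂` is a prime ideal** (`3 ≠ 0` in `k`). [folklore] -/
theorem isPrime_chartTwo (k : Type) [Field k] (h3 : (3 : k) ≠ 0)
    (g₂ : MvPolynomial (Fin 5) k) (hg₂ : g₂ = X 0 * X 1 + X 2 * (1 + X 3 ^ 3 + X 4 ^ 3))
    (c₂ : Fin 4 → MvPolynomial (Fin 5) k) (hc₂ : c₂ = ![X 0, X 1, X 2, 1 + X 3 ^ 3 + X 4 ^ 3])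
    (J₂ : Ideal (MvPolynomial (Fin 5) k ⧸ Ideal.span {g₂})) (hJ₂ : J₂ = (Ideal.span (Set.range c₂)).map (Ideal.Quotient.mk (Ideal.span {g₂}))) :
    J₂.IsPrime :=
  haveI := E4FloorTwoWChart.isDomain_quotient_g k h3 (1 + X 0 ^ 3 + X 1 ^ 3) rfl
  isPrime_chartTwo_aux k (RingEquiv.refl _) (1 + X 0 ^ 3 + X 1 ^ 3) rfl g₂ hg₂ c₂ hc₂ J₂ hJ₂

/-! ## §3 The charts `D₊(w₂)`, `D₊(w₃)` by the variable swaps `(2 3)`, `(2 4)` -/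

/-- `rename` on a variable under a swap. [plumbing] -/
theorem rename_swap_X (k : Type) [Field k] (a b j : Fin 5) :
    rename (Equiv.swap a b) (X j : MvPolynomial (Fin 5) k) = X (Equiv.swap a b j) :=
  rename_X _ j

/-- ★★ **Chart `D₊(w₂)`: `C₃ = k[X]/(X₀X₁ + X₃(1 + X₂³ + X₄³))`, centre `J₃ = (X₀, X₁, X₃, 1 + X₂³ + X₄³)`** — the four chart rings of `Bl_{J₃} Spec C₃` are regular,
`Sing(Spec C₃) = V(J₃)`, and `J₃` is prime (`3 ≠ 0` in `k`); from the `D₊(w₁)` chart by the swap `(2 3)`. [folklore; cite: Liu2002, Thm. 8.1.19 (a)] -/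
theorem chartThree (k : Type) [Field k] (h3 : (3 : k) ≠ 0)
    (g₃ : MvPolynomial (Fin 5) k) (hg₃ : g₃ = X 0 * X 1 + X 3 * (1 + X 2 ^ 3 + X 4 ^ 3))
    (c₃ : Fin 4 → MvPolynomial (Fin 5) k) (hc₃ : c₃ = ![X 0, X 1, X 3, 1 + X 2 ^ 3 + X 4 ^ 3])
    (J₃ : Ideal (MvPolynomial (Fin 5) k ⧸ Ideal.span {g₃})) (hJ₃ : J₃ = (Ideal.span (Set.range c₃)).map (Ideal.Quotient.mk (Ideal.span {g₃}))) :
    (∀ p : Fin 4, IsRegularRing (blowupAlgebra J₃ (Ideal.Quotient.mk (Ideal.span {g₃}) (c₃ p)))) ∧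
      (∀ (P : Ideal (MvPolynomial (Fin 5) k ⧸ Ideal.span {g₃})) [P.IsPrime], ¬ IsRegularLocalRing (Localization.AtPrime P) ↔ J₃ ≤ P) ∧ J₃.IsPrime := by
  have hsw : ∀ j : Fin 5, rename (Equiv.swap (2 : Fin 5) 3) (X j : MvPolynomial (Fin 5) k) =
      X ((![0, 1, 3, 2, 4] : Fin 5 → Fin 5) j) := by
    intro j
    rw [rename_swap_X]
    congr 1
    revert j
    decide
  have hgg' : rename (Equiv.swap (2 : Fin 5) 3) g₃ = X 0 * X 1 + X 2 * (1 + X 3 ^ 3 + X 4 ^ 3) := by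
    rw [hg₃]
    simp only [map_add, map_mul, map_pow, map_one, hsw]
    rfl
  have hcc' : ∀ p, rename (Equiv.swap (2 : Fin 5) 3) (c₃ p) =
      (![X 0, X 1, X 2, 1 + X 3 ^ 3 + X 4 ^ 3] : Fin 4 → MvPolynomial (Fin 5) k) p := by
    intro p
    subst hc₃
    fin_cases p
    · exact hsw 0
    · exact hsw 1
    · exact hsw 3
    · show rename _ (1 + X 2 ^ 3 + X 4 ^ 3) = 1 + X 3 ^ 3 + X 4 ^ 3
      simp only [map_add, map_pow, map_one, hsw]
      rfl
  obtain ⟨εq, hεq, hJ⟩ := exists_quotientEquiv_rename k (Equiv.swap (2 : Fin 5) 3) _ g₃ hgg' _ c₃ hcc' _ rfl J₃ hJ₃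
  exact transport_of_quotientEquiv εq _ _ hεq J₃ _ hJ
    (E4FloorTwoWChart.isRegularRing_blowupAlgebra_chartTwo k h3 _ rfl _ rfl _ rfl)
    (fun Q _ => E4FloorTwoWChart.not_isRegularLocalRing_iff_chartTwo k h3 _ rfl _ rfl _ rfl Q) (isPrime_chartTwo k h3 _ rfl _ rfl _ rfl)

/-- ★★ **`Bl_{J₃} Spec C₃` is a regular scheme** (`3 ≠ 0` in `k`). [folklore; cite: Liu2002, Thm. 8.1.19 (a)] -/
theorem isRegular_affineBlowup_chartThree (k : Type) [Field k] (h3 : (3 : k) ≠ 0)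
    (g₃ : MvPolynomial (Fin 5) k) (hg₃ : g₃ = X 0 * X 1 + X 3 * (1 + X 2 ^ 3 + X 4 ^ 3))
    (c₃ : Fin 4 → MvPolynomial (Fin 5) k) (hc₃ : c₃ = ![X 0, X 1, X 3, 1 + X 2 ^ 3 + X 4 ^ 3])
    (J₃ : Ideal (MvPolynomial (Fin 5) k ⧸ Ideal.span {g₃})) (hJ₃ : J₃ = (Ideal.span (Set.range c₃)).map (Ideal.Quotient.mk (Ideal.span {g₃}))) :
    Scheme.IsRegular (affineBlowup J₃) := by
  refine affineBlowup.isRegular_of_isRegularRing_blowupAlgebra (fun p : Fin 4 => Ideal.Quotient.mk (Ideal.span {g₃}) (c₃ p))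
    (fun p => ?_) ?_ (chartThree k h3 g₃ hg₃ c₃ hc₃ J₃ hJ₃).1
  · rw [hJ₃]; exact Ideal.mem_map_of_mem _ (Ideal.subset_span ⟨p, rfl⟩)
  · rw [hJ₃, Ideal.map_span, ← Set.range_comp]
    exact le_rfl

/-- ★★ **Chart `D₊(w₃)`: `C₄ = k[X]/(X₀X₁ + X₄(1 + X₂³ + X₃³))`, centre `J₄ = (X₀, X₁, X₄, 1 + X₂³ + X₃³)`** — the four chart rings of `Bl_{J₄} Spec C₄` are regular,
`Sing(Spec C₄) = V(J₄)`, and `J₄` is prime (`3 ≠ 0` in `k`); from the `D₊(w₁)` chart by the swap `(2 4)`. [folklore; cite: Liu2002, Thm. 8.1.19 (a)] -/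
theorem chartFour (k : Type) [Field k] (h3 : (3 : k) ≠ 0)
    (g₄ : MvPolynomial (Fin 5) k) (hg₄ : g₄ = X 0 * X 1 + X 4 * (1 + X 2 ^ 3 + X 3 ^ 3))
    (c₄ : Fin 4 → MvPolynomial (Fin 5) k) (hc₄ : c₄ = ![X 0, X 1, X 4, 1 + X 2 ^ 3 + X 3 ^ 3])
    (J₄ : Ideal (MvPolynomial (Fin 5) k ⧸ Ideal.span {g₄})) (hJ₄ : J₄ = (Ideal.span (Set.range c₄)).map (Ideal.Quotient.mk (Ideal.span {g₄}))) :
    (∀ p : Fin 4, IsRegularRing (blowupAlgebra J₄ (Ideal.Quotient.mk (Ideal.span {g₄}) (c₄ p)))) ∧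
      (∀ (P : Ideal (MvPolynomial (Fin 5) k ⧸ Ideal.span {g₄})) [P.IsPrime], ¬ IsRegularLocalRing (Localization.AtPrime P) ↔ J₄ ≤ P) ∧ J₄.IsPrime := by
  have hsw : ∀ j : Fin 5, rename (Equiv.swap (2 : Fin 5) 4) (X j : MvPolynomial (Fin 5) k) =
      X ((![0, 1, 4, 3, 2] : Fin 5 → Fin 5) j) := by
    intro j
    rw [rename_swap_X]
    congr 1
    revert j
    decide
  have hgg' : rename (Equiv.swap (2 : Fin 5) 4) g₄ = X 0 * X 1 + X 2 * (1 + X 3 ^ 3 + X 4 ^ 3) := by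
    rw [hg₄]
    simp only [map_add, map_mul, map_pow, map_one, hsw]
    show (X 0 * X 1 + X 2 * (1 + X 4 ^ 3 + X 3 ^ 3) : MvPolynomial (Fin 5) k) = X 0 * X 1 + X 2 * (1 + X 3 ^ 3 + X 4 ^ 3)
    ring
  have hcc' : ∀ p, rename (Equiv.swap (2 : Fin 5) 4) (c₄ p) =
      (![X 0, X 1, X 2, 1 + X 3 ^ 3 + X 4 ^ 3] : Fin 4 → MvPolynomial (Fin 5) k) p := by
    intro p
    subst hc₄
    fin_cases p
    · exact hsw 0
    · exact hsw 1
    · exact hsw 4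
    · show rename _ (1 + X 2 ^ 3 + X 3 ^ 3) = 1 + X 3 ^ 3 + X 4 ^ 3
      simp only [map_add, map_pow, map_one, hsw]
      show (1 + X 4 ^ 3 + X 3 ^ 3 : MvPolynomial (Fin 5) k) = 1 + X 3 ^ 3 + X 4 ^ 3
      ring
  obtain ⟨εq, hεq, hJ⟩ := exists_quotientEquiv_rename k (Equiv.swap (2 : Fin 5) 4) _ g₄ hgg' _ c₄ hcc' _ rfl J₄ hJ₄
  exact transport_of_quotientEquiv εq _ _ hεq J₄ _ hJ
    (E4FloorTwoWChart.isRegularRing_blowupAlgebra_chartTwo k h3 _ rfl _ rfl _ rfl)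
    (fun Q _ => E4FloorTwoWChart.not_isRegularLocalRing_iff_chartTwo k h3 _ rfl _ rfl _ rfl Q) (isPrime_chartTwo k h3 _ rfl _ rfl _ rfl)

/-- ★★ **`Bl_{J₄} Spec C₄` is a regular scheme** (`3 ≠ 0` in `k`). [folklore; cite: Liu2002, Thm. 8.1.19 (a)] -/
theorem isRegular_affineBlowup_chartFour (k : Type) [Field k] (h3 : (3 : k) ≠ 0)
    (g₄ : MvPolynomial (Fin 5) k) (hg₄ : g₄ = X 0 * X 1 + X 4 * (1 + X 2 ^ 3 + X 3 ^ 3))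
    (c₄ : Fin 4 → MvPolynomial (Fin 5) k) (hc₄ : c₄ = ![X 0, X 1, X 4, 1 + X 2 ^ 3 + X 3 ^ 3])
    (J₄ : Ideal (MvPolynomial (Fin 5) k ⧸ Ideal.span {g₄})) (hJ₄ : J₄ = (Ideal.span (Set.range c₄)).map (Ideal.Quotient.mk (Ideal.span {g₄}))) :
    Scheme.IsRegular (affineBlowup J₄) := by
  refine affineBlowup.isRegular_of_isRegularRing_blowupAlgebra (fun p : Fin 4 => Ideal.Quotient.mk (Ideal.span {g₄}) (c₄ p))
    (fun p => ?_) ?_ (chartFour k h3 g₄ hg₄ c₄ hc₄ J₄ hJ₄).1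
  · rw [hJ₄]; exact Ideal.mem_map_of_mem _ (Ideal.subset_span ⟨p, rfl⟩)
  · rw [hJ₄, Ideal.map_span, ← Set.range_comp]
    exact le_rfl

end Summit.ResolutionOfSingularities.ResolutionOfSingularities.Theorems.FInjectiveMacaulayfication.E4FloorTwoCharts

end
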